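import Summits.ABC.StewartYu.PadicW80SizesL
import Summits.ABC.StewartYu.PadicW80BudgetsL
import HarnessLib

/-!
# The `(log p)`-normalised record `PadicW80ParL` — SHARP closed forms for the half step of the
# `p ≡ 1 (mod 4)` twist (provider B: Liouville exponent `2^{d+2}`)

Support file (plain definitions + theorems; no named facts), cell `abc-stewartyu` (seat p1;
interface asked by the planner 2026-08-26 08:39Z (3) and p3 09:19Z/10:03Z for crux
`W80OneModFour`, stmt-ABC-19487).  The landed closed forms of `PadicW80ParL.lean`
(`DmaxH = 𝔅²E(2)`, `MmaxH = 𝔅·PrV·DmaxH`, `PrV = 2𝔅⁵E(2)`, `𝔅 = exp(𝔘/64)`) spend `12·(𝔘/64)` in the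
half-step threshold `2^{d+1}·log(4·DmaxH²·MmaxH·H³)`, which fits the budget `(7/16)·2ᵈ𝔘` at the
Liouville exponent `2^{d+1}` (provider A, one square-root class field) but NOT at `2^{d+2}`
(provider B: the extra root `ι = √−1`).  The true sizes are much smaller: of the four
`exp(𝔘/256)`-factors of the landed size lemmas only `ν(x,h)^T` is `𝔅`-sized
(`T·log ν ≤ 240·T·W⋆ ≤ 240·𝔘/c_T = 15·𝔘/1024`); `|qA| ≤ exp(12𝔘/c_T)`, `|b_θ|^k ≤ exp(𝔘/c_T)`,
`T^T ≤ exp(10𝔘/c_T)`, `2^{hL_b}`, `(e(x+h)/h)^{hL_b}`, `#box_J ≤ (2U)^{d+2}` are all below the FINE UNIT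
`𝔔 := exp(𝔘/1024) = 𝔅^{1/16}`.  This file: the unit `𝔔` and the record-side sharp powers
(`T^k, 2^{hL_b}, (e(x+h)/h)^{hL_b} ≤ 𝔔`, `ν^k ≤ 𝔔¹⁵`), the sharp closed forms
`AmaxPM = 𝔔²¹E(2)` (Siegel), `PrVPM = 2𝔔²²E(2) ≤ PrV` (coefficients), `DmaxHPM = 𝔔¹⁶E(2)`,
`RHalfPM = 𝔔⁵E(2)`, `MmaxHPM = 𝔔·PrVPM·RHalfPM` (half points), and the **provider-B budget**
`2^{d+2}·log(4·DmaxHPM²·MmaxHPM·H³) − log DmaxHPM ≤ (7/16)·2ᵈ𝔘` — the SAME right-hand side as the landed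
`bhalf_le_budget`, so `PadicW80NumericLB.halfstep_ineq_one/two` apply verbatim (no change of `T`, `t_J`
or the record).  The frame-side sharp sizes are in `PadicW80SizesLPM.lean`.
Everything is [folklore]; design note HOME/p1/S6-providerB-halfstep.md.

## References
* [Waldschmidt1980] M. Waldschmidt, *A lower bound for linear forms in logarithms*, Acta Arith. 37
  (1980) — §3.4 (3.21)–(3.22) (pp. 269–270), Lemma 3.7 (pp. 272–273).
* [Yu1990] K. Yu, *Linear forms in p-adic logarithms II*, Compositio Math. 74 (1990) — §2.4
  Lemmas 2.4–2.5, (2.31) (p. 36).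
-/

noncomputable section

open Finset Real
open Literature.NumberTheory.Transcendental
open Literature.NumberTheory.Transcendental.Baker1975
open Literature.NumberTheory.Transcendental.Baker1975.Ch3
open Literature.NumberTheory.Transcendental.CW77

namespace Summit.ABC.StewartYu

open PadicW80Par (cTp cSp cLp cLp' Ap mRp)

namespace PadicW80ParL

variable {d : ℕ} (P : PadicW80ParL d)

/-! ### The fine unit `𝔔 = exp(𝔘/1024)` -/

/-- **The fine unit `𝔔 = exp(𝔘/1024)`** of the sharp sizes (`𝔔¹⁶ = 𝔅`). [folklore] -/
def 𝔔ℓ : ℝ := Real.exp (P.𝔘ℓ / 1024)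

/-- `0 < 𝔔`. [folklore] -/
theorem 𝔔_pos : 0 < P.𝔔ℓ := Real.exp_pos _

/-- `1 ≤ 𝔔`. [folklore] -/
theorem one_le_𝔔 : 1 ≤ P.𝔔ℓ := Real.one_le_exp (div_nonneg P.𝔘_pos.le (by norm_num))

/-- `𝔔ⁿ = exp(n·𝔘/1024)`. [folklore] -/
theorem 𝔔_pow_eq (n : ℕ) : P.𝔔ℓ ^ n = Real.exp (n * (P.𝔘ℓ / 1024)) := by
  unfold 𝔔ℓ; rw [← Real.exp_nat_mul]

/-- `log 𝔔ⁿ = n·𝔘/1024`. [folklore] -/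
theorem log_𝔔_pow (n : ℕ) : Real.log (P.𝔔ℓ ^ n) = n * (P.𝔘ℓ / 1024) := by
  rw [P.𝔔_pow_eq, Real.log_exp]

/-- `𝔔¹⁶ = 𝔅`. [folklore] -/
theorem 𝔔_pow_sixteen : P.𝔔ℓ ^ 16 = P.𝔅ℓ := by
  rw [P.𝔔_pow_eq]; unfold 𝔅ℓ; congr 1; push_cast; ring

/-- `1 ≤ 𝔔ⁿ`. [folklore] -/
theorem one_le_𝔔_pow (n : ℕ) : 1 ≤ P.𝔔ℓ ^ n := one_le_pow₀ P.one_le_𝔔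

/-- `exp y ≤ 𝔔ⁿ` when `y ≤ n·𝔘/1024`. [folklore] -/
theorem exp_le_𝔔_pow {y : ℝ} {n : ℕ} (hy : y ≤ n * (P.𝔘ℓ / 1024)) : Real.exp y ≤ P.𝔔ℓ ^ n := by
  rw [P.𝔔_pow_eq]; exact Real.exp_le_exp.mpr hy

/-- `exp y ≤ 𝔔` when `y ≤ 𝔘/1024`. [folklore] -/
theorem exp_le_𝔔 {y : ℝ} (hy : y ≤ P.𝔘ℓ / 1024) : Real.exp y ≤ P.𝔔ℓ := Real.exp_le_exp.mpr hy

/-- `y ≤ 𝔔ⁿ` when `log y ≤ n·𝔘/1024`. [folklore] -/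
theorem le_𝔔_pow_of_log_le {y : ℝ} {n : ℕ} (hy : Real.log y ≤ n * (P.𝔘ℓ / 1024)) : y ≤ P.𝔔ℓ ^ n := by
  rcases le_or_gt y 0 with h | h
  · exact h.trans (pow_pos P.𝔔_pos n).le
  · rw [← Real.exp_log h]; exact P.exp_le_𝔔_pow hy

/-- `y ≤ 𝔔` when `log y ≤ 𝔘/1024`. [folklore] -/
theorem le_𝔔_of_log_le {y : ℝ} (hy : Real.log y ≤ P.𝔘ℓ / 1024) : y ≤ P.𝔔ℓ := by
  have := P.le_𝔔_pow_of_log_le (n := 1) (by simpa using hy)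
  simpa using this

/-- Products of quantities `≤ 𝔔ⁱ`. [folklore] -/
theorem mul_le_𝔔_pow {a b : ℝ} {i j : ℕ} (ha : a ≤ P.𝔔ℓ ^ i) (hb : b ≤ P.𝔔ℓ ^ j) (hb0 : 0 ≤ b) :
    a * b ≤ P.𝔔ℓ ^ (i + j) := by
  rw [pow_add]
  have h𝔔 := P.𝔔_pos
  calc a * b ≤ P.𝔔ℓ ^ i * b := mul_le_mul_of_nonneg_right ha hb0
    _ ≤ P.𝔔ℓ ^ i * P.𝔔ℓ ^ j := mul_le_mul_of_nonneg_left hb (by positivity)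

/-! ### Sharp record-side powers -/

/-- **`T^T ≤ 𝔔`** (`T log T ≤ 10·T·W⋆ ≤ 10𝔘/c_T`). [folklore] -/
theorem T_pow_T_le_𝔔 : (P.Tℓ : ℝ) ^ P.Tℓ ≤ P.𝔔ℓ := by
  have hT := P.T_pos
  refine P.le_𝔔_of_log_le ?_
  rw [Real.log_pow]
  have h1 := P.log_T_le; have h2 := P.TWstar_le; have hU := P.𝔘_pos
  calc (P.Tℓ : ℝ) * Real.log P.Tℓ ≤ P.Tℓ * (10 * P.Wstarℓ) := mul_le_mul_of_nonneg_left h1 hT.le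
    _ = 10 * (P.Tℓ * P.Wstarℓ) := by ring
    _ ≤ 10 * (P.𝔘ℓ / cTp) := by gcongr
    _ ≤ P.𝔘ℓ / 1024 := by unfold cTp; nlinarith

/-- `T^k ≤ 𝔔` for `k ≤ T`. [folklore] -/
theorem T_pow_le_𝔔 {k : ℕ} (hk : k ≤ P.Tℓ) : (P.Tℓ : ℝ) ^ k ≤ P.𝔔ℓ := by
  have h1 : (1 : ℝ) ≤ P.Tℓ := by exact_mod_cast P.one_le_T
  exact (pow_le_pow_right₀ h1 hk).trans P.T_pow_T_le_𝔔

/-- **`2^{h L_b} ≤ 𝔔`** (`hL_b ≤ 𝔘/c_L + 4W⋆`). [folklore] -/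
theorem two_pow_hLb_le_𝔔 : (2 : ℝ) ^ (P.hparℓ * P.Lbℓ) ≤ P.𝔔ℓ := by
  have h2 : (2 : ℝ) = Real.exp (Real.log 2) := (Real.exp_log two_pos).symm
  rw [h2, ← Real.exp_nat_mul]
  refine P.exp_le_𝔔 ?_
  push_cast
  have h1 := P.hparLb_le; have hW := P.Wstar_le_𝔘; have hU := P.𝔘_pos
  have hl2 : Real.log 2 ≤ 1 := by linarith [Real.log_two_lt_d9]
  have h0 : (0 : ℝ) ≤ P.hparℓ * P.Lbℓ := by positivity
  calc ((P.hparℓ : ℝ) * P.Lbℓ) * Real.log 2 ≤ (P.hparℓ * P.Lbℓ) * 1 := mul_le_mul_of_nonneg_left hl2 h0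
    _ ≤ P.𝔘ℓ / cLp + 4 * P.Wstarℓ := by linarith
    _ ≤ P.𝔘ℓ / 1024 := by unfold cLp; nlinarith

/-- **`(e(x+h)/h)^{h L_b} ≤ 𝔔`** for `x ≤ Xpt` (`7·hL_b·G`-sized). [cite: Waldschmidt1980, (3.13)–(3.14) (p. 265)] -/
theorem ratio_pow_le_𝔔 {x : ℕ} (hx : (x : ℝ) ≤ P.Xptℓ) :
    (Real.exp 1 * ((x : ℝ) + P.hparℓ) / P.hparℓ) ^ (P.hparℓ * P.Lbℓ) ≤ P.𝔔ℓ := by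
  have hh := P.hpar_pos
  have hbase : 1 ≤ Real.exp 1 * ((x : ℝ) + P.hparℓ) / P.hparℓ := by
    rw [le_div_iff₀ hh]
    have := Real.exp_one_gt_two; have := Nat.cast_nonneg (α := ℝ) x
    nlinarith
  have hpos : 0 < Real.exp 1 * ((x : ℝ) + P.hparℓ) / P.hparℓ := by linarith
  refine P.le_𝔔_of_log_le ?_
  rw [Real.log_pow]
  have h1 : Real.log (Real.exp 1 * ((x : ℝ) + P.hparℓ) / P.hparℓ) =
      1 + Real.log (((x : ℝ) + P.hparℓ) / P.hparℓ) := by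
    rw [mul_div_assoc, Real.log_mul (Real.exp_pos 1).ne' (by positivity), Real.log_exp]
  rw [h1]
  have h2 : Real.log (((x : ℝ) + P.hparℓ) / P.hparℓ) ≤ 6 * P.Gℓ := by
    refine le_trans (Real.log_le_log (by positivity) ?_) P.log_Xpt_div_le_six
    exact div_le_div_of_nonneg_right (by linarith) hh.le
  have hG := P.one_le_G
  have h3 := P.hparLbG_le; have hW := P.Wstar_le_𝔘; have hGU := P.G_le_𝔘; have hU := P.𝔘_pos
  have h0 : (0 : ℝ) ≤ P.hparℓ * P.Lbℓ := by positivity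
  push_cast
  calc ((P.hparℓ : ℝ) * P.Lbℓ) * (1 + Real.log (((x : ℝ) + P.hparℓ) / P.hparℓ))
      ≤ (P.hparℓ * P.Lbℓ) * (7 * P.Gℓ) := mul_le_mul_of_nonneg_left (by linarith) h0
    _ = 7 * (P.hparℓ * P.Lbℓ * P.Gℓ) := by ring
    _ ≤ 7 * (P.𝔘ℓ / cLp + (P.Wstarℓ + P.Gℓ)) := by gcongr
    _ ≤ P.𝔘ℓ / 1024 := by unfold cLp; nlinarith

/-- **`ν(x, h)^k ≤ 𝔔¹⁵`** for `x ≤ Xpt`, `k ≤ T` (`T·log ν ≤ 240·T·W⋆ ≤ 240𝔘/c_T = 15𝔘/1024`): the one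
`𝔅`-sized factor of the sizes. [cite: Waldschmidt1980, §3.4 (3.21) (p. 269)] -/
theorem nuBound_pow_le_𝔔 {x k : ℕ} (hx : (x : ℝ) ≤ P.Xptℓ) (hk : k ≤ P.Tℓ) :
    ((nuBound x P.hparℓ : ℕ) : ℝ) ^ k ≤ P.𝔔ℓ ^ 15 := by
  have hν1 : (1 : ℝ) ≤ nuBound x P.hparℓ := by exact_mod_cast nuBound_pos x P.hparℓ
  refine (pow_le_pow_right₀ hν1 hk).trans (P.le_𝔔_pow_of_log_le ?_)
  rw [Real.log_pow]
  have h1 := Waldschmidt1980.W80Par.log_nuBound_le_one_le (x := x) P.one_le_hpar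
  have hh := P.hpar_pos
  have h2 : Real.log (((x : ℝ) + P.hparℓ) / P.hparℓ) ≤ 6 * P.Gℓ := by
    refine le_trans (Real.log_le_log (by positivity) ?_) P.log_Xpt_div_le_six
    exact div_le_div_of_nonneg_right (by linarith) hh.le
  have hG := P.one_le_G
  have h3 : Real.log (nuBound x P.hparℓ) ≤ P.hparℓ * (60 * P.Gℓ) := by
    refine h1.trans (mul_le_mul_of_nonneg_left ?_ hh.le)
    linarith
  have hT := P.T_pos; have hTW := P.TWstar_le; have hGW := P.G_le_three_Wstar; have hhG := P.hparG_le
  have hU := P.𝔘_pos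
  push_cast
  calc (P.Tℓ : ℝ) * Real.log (nuBound x P.hparℓ) ≤ P.Tℓ * (P.hparℓ * (60 * P.Gℓ)) :=
        mul_le_mul_of_nonneg_left h3 hT.le
    _ = 60 * P.Tℓ * (P.hparℓ * P.Gℓ) := by ring
    _ ≤ 60 * P.Tℓ * (P.Wstarℓ + P.Gℓ) := by gcongr
    _ ≤ 60 * P.Tℓ * (4 * P.Wstarℓ) := by gcongr; linarith
    _ = 240 * (P.Tℓ * P.Wstarℓ) := by ring
    _ ≤ 240 * (P.𝔘ℓ / cTp) := by gcongr
    _ = 15 * (P.𝔘ℓ / 1024) := by unfold cTp; ring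

/-! ### The sharp closed forms -/

/-- **`AmaxPM = 𝔔²¹ E(2)`**: the bound of Siegel's step `|D(s,τ)·qTerm| ≤ AmaxPM` on the box of level `0`
(`D ≤ 𝔔¹⁶E(1)`, `|qTerm| ≤ 𝔔⁵E(1)`). [folklore] -/
def AmaxPMℓ : ℝ := P.𝔔ℓ ^ 21 * P.Efacℓ 2

/-- **`PrVPM = 2 𝔔²² E(2)`**: the bound of the integer coefficients `|p(u)| ≤ ⌈#box₀ · AmaxPM⌉ ≤ PrVPM`. [folklore] -/
def PrVPMℓ : ℝ := 2 * P.𝔔ℓ ^ 22 * P.Efacℓ 2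

/-- **`DmaxHPM = 𝔔¹⁶ E(2)`**: the clearing denominator of the half points (`ν^{τ₀}·|b_θ|^{∑τ'}·den`). [folklore] -/
def DmaxHPMℓ : ℝ := P.𝔔ℓ ^ 16 * P.Efacℓ 2

/-- **`RHalfPM = 𝔔⁵ E(2)`**: the archimedean size of one term `rHalf = qΔ·qA·qEh` at a half point. [folklore] -/
def RHalfPMℓ : ℝ := P.𝔔ℓ ^ 5 * P.Efacℓ 2

/-- **`MmaxHPM = 𝔔 · PrVPM · RHalfPM`** (`#box ≤ 𝔔`): the archimedean size `∑_{u ∈ box} |p(u)|·|rHalf(u)|` of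
the class sums at a half point. [folklore] -/
def MmaxHPMℓ : ℝ := P.𝔔ℓ * P.PrVPMℓ * P.RHalfPMℓ

/-- `0 < AmaxPM`. [folklore] -/
theorem AmaxPM_pos : 0 < P.AmaxPMℓ := by
  unfold AmaxPMℓ; have := P.𝔔_pos; have := P.Efacp_pos 2; positivity

/-- `1 ≤ AmaxPM`. [folklore] -/
theorem one_le_AmaxPM : 1 ≤ P.AmaxPMℓ := by
  unfold AmaxPMℓ
  exact one_le_mul_of_one_le_of_one_le (P.one_le_𝔔_pow 21) (P.one_le_Efacp (by norm_num))

/-- `0 < PrVPM`. [folklore] -/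
theorem PrVPM_pos : 0 < P.PrVPMℓ := by
  unfold PrVPMℓ; have := P.𝔔_pos; have := P.Efacp_pos 2; positivity

/-- `1 ≤ PrVPM`. [folklore] -/
theorem one_le_PrVPM : 1 ≤ P.PrVPMℓ := by
  unfold PrVPMℓ
  have h1 := P.one_le_𝔔_pow 22; have h2 := P.one_le_Efacp (show (0 : ℝ) ≤ 2 by norm_num)
  nlinarith

/-- `𝔔 · AmaxPM + 1 ≤ PrVPM` (the ceiling `⌈#box₀·AmaxPM⌉` with `#box₀ ≤ 𝔔` is `≤ PrVPM`). [folklore] -/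
theorem 𝔔_mul_AmaxPM_add_one_le : P.𝔔ℓ * P.AmaxPMℓ + 1 ≤ P.PrVPMℓ := by
  unfold AmaxPMℓ PrVPMℓ
  have h1 : 1 ≤ P.𝔔ℓ ^ 22 * P.Efacℓ 2 :=
    one_le_mul_of_one_le_of_one_le (P.one_le_𝔔_pow 22) (P.one_le_Efacp (by norm_num))
  have e : P.𝔔ℓ * (P.𝔔ℓ ^ 21 * P.Efacℓ 2) = P.𝔔ℓ ^ 22 * P.Efacℓ 2 := by ring
  rw [e]; linarith

/-- **`PrVPM ≤ PrV`** (`𝔔²² ≤ 𝔔⁸⁰ = 𝔅⁵`): the landed `KSizes` junction (`|p(u)| ≤ Pint ≤ PrV`) is reused. [folklore] -/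
theorem PrVPM_le_PrV : P.PrVPMℓ ≤ P.PrVℓ := by
  unfold PrVPMℓ PrVℓ
  rw [← P.𝔔_pow_sixteen, ← pow_mul]
  have h1 : P.𝔔ℓ ^ 22 ≤ P.𝔔ℓ ^ (16 * 5) := pow_le_pow_right₀ P.one_le_𝔔 (by norm_num)
  have hE := P.Efacp_pos 2
  nlinarith

/-- `0 < DmaxHPM`. [folklore] -/
theorem DmaxHPM_pos : 0 < P.DmaxHPMℓ := by
  unfold DmaxHPMℓ; have := P.𝔔_pos; have := P.Efacp_pos 2; positivity

/-- `1 ≤ DmaxHPM`. [folklore] -/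
theorem one_le_DmaxHPM : 1 ≤ P.DmaxHPMℓ := by
  unfold DmaxHPMℓ
  exact one_le_mul_of_one_le_of_one_le (P.one_le_𝔔_pow 16) (P.one_le_Efacp (by norm_num))

/-- `0 < RHalfPM`. [folklore] -/
theorem RHalfPM_pos : 0 < P.RHalfPMℓ := by
  unfold RHalfPMℓ; have := P.𝔔_pos; have := P.Efacp_pos 2; positivity

/-- `1 ≤ RHalfPM`. [folklore] -/
theorem one_le_RHalfPM : 1 ≤ P.RHalfPMℓ := by
  unfold RHalfPMℓ
  exact one_le_mul_of_one_le_of_one_le (P.one_le_𝔔_pow 5) (P.one_le_Efacp (by norm_num))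

/-- `0 < MmaxHPM`. [folklore] -/
theorem MmaxHPM_pos : 0 < P.MmaxHPMℓ := by
  unfold MmaxHPMℓ; have := P.𝔔_pos; have := P.PrVPM_pos; have := P.RHalfPM_pos; positivity

/-- `1 ≤ MmaxHPM`. [folklore] -/
theorem one_le_MmaxHPM : 1 ≤ P.MmaxHPMℓ := by
  unfold MmaxHPMℓ
  exact one_le_mul_of_one_le_of_one_le (one_le_mul_of_one_le_of_one_le P.one_le_𝔔 P.one_le_PrVPM)
    P.one_le_RHalfPM

/-- `DmaxHPM ≤ DmaxH` (`𝔔¹⁶ = 𝔅 ≤ 𝔅²`). [folklore] -/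
theorem DmaxHPM_le_DmaxH : P.DmaxHPMℓ ≤ P.DmaxHℓ := by
  unfold DmaxHPMℓ DmaxHℓ
  rw [P.𝔔_pow_sixteen]
  have h1 : P.𝔅ℓ ≤ P.𝔅ℓ ^ 2 := by
    have := P.one_le_𝔅; nlinarith
  have hE := P.Efacp_pos 2
  nlinarith

/-! ### Logarithms of the sharp closed forms -/

/-- `log E(2) = 𝔘/c_L'` (`= 2·𝔘/(2c_L')`). [folklore] -/
theorem log_Efac_two : Real.log (P.Efacℓ 2) = 2 * (P.𝔘ℓ / (2 * cLp')) := by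
  unfold Efacℓ; rw [Real.log_exp]

/-- `log DmaxHPM = 16·𝔘/1024 + 2·𝔘/(2c_L')`. [folklore] -/
theorem log_DmaxHPM : Real.log P.DmaxHPMℓ = 16 * (P.𝔘ℓ / 1024) + 2 * (P.𝔘ℓ / (2 * cLp')) := by
  unfold DmaxHPMℓ
  rw [Real.log_mul (pow_pos P.𝔔_pos _).ne' (P.Efacp_pos 2).ne', P.log_𝔔_pow, P.log_Efac_two]
  push_cast; ring

/-- `log MmaxHPM = log 2 + 28·𝔘/1024 + 4·𝔘/(2c_L')`. [folklore] -/
theorem log_MmaxHPM : Real.log P.MmaxHPMℓ = Real.log 2 + 28 * (P.𝔘ℓ / 1024) + 4 * (P.𝔘ℓ / (2 * cLp')) := by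
  have h𝔔 := P.𝔔_pos; have hE := P.Efacp_pos 2
  have e : P.MmaxHPMℓ = 2 * (P.𝔔ℓ ^ 28 * (P.Efacℓ 2 * P.Efacℓ 2)) := by
    unfold MmaxHPMℓ PrVPMℓ RHalfPMℓ; ring
  rw [e, Real.log_mul (by norm_num) (by positivity), Real.log_mul (by positivity) (by positivity),
    Real.log_mul hE.ne' hE.ne', P.log_𝔔_pow, P.log_Efac_two]
  push_cast; ring

/-! ### The provider-B budget of the half step (Liouville exponent `2^{d+2}`) -/

/-- **Budget of the half step for provider B** (`p ≡ 1 (mod 4)`: one extra root `ι`, Liouville exponent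
`2^{d+2}`): with `1 ≤ Hprod ≤ exp(∑V + V_θ)`,
`2^{d+2}·log(4·DmaxHPM²·MmaxHPM·Hprod³) − log DmaxHPM ≤ (7/16)·2ᵈ·𝔘` — the SAME right-hand side as the
landed `bhalf_le_budget` (exponent `2^{d+1}`, coarse closed forms), so `halfstep_ineq_one/two` apply verbatim.
The bracket is `≤ log 8 + 60·𝔘/1024 + 4·𝔘/2¹² + 3·𝔘/2⁹⁰ ≤ 0.0596·𝔘 (+ log 8)`, times `2^{d+2}`:
`≤ 0.24·2ᵈ𝔘`. [cite: Waldschmidt1980, Lemma 3.7 (pp. 272–273)] [cite: Yu1990, §2.4 Lemma 2.5] -/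
theorem bhalf_le_budget_pm {Hprod : ℝ} (hH1 : 1 ≤ Hprod) (hH : Hprod ≤ Real.exp ((∑ j, P.V j) + P.Vθ)) :
    (2 : ℝ) ^ (d + 2) * Real.log (4 * P.DmaxHPMℓ ^ 2 * P.MmaxHPMℓ * Hprod ^ 3) - Real.log P.DmaxHPMℓ ≤
      7 / 16 * (2 ^ d * P.𝔘ℓ) := by
  have hD1 := P.one_le_DmaxHPM; have hM1 := P.one_le_MmaxHPM
  have hlogD : 0 ≤ Real.log P.DmaxHPMℓ := Real.log_nonneg hD1
  have hlogH : Real.log Hprod ≤ (∑ j, P.V j) + P.Vθ := by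
    have := Real.log_le_log (by linarith) hH; rwa [Real.log_exp] at this
  have hlogH0 : 0 ≤ Real.log Hprod := Real.log_nonneg hH1
  have hsum := P.sumV_le_𝔘
  have e : Real.log (4 * P.DmaxHPMℓ ^ 2 * P.MmaxHPMℓ * Hprod ^ 3) =
      Real.log 4 + 2 * Real.log P.DmaxHPMℓ + Real.log P.MmaxHPMℓ + 3 * Real.log Hprod := by
    rw [Real.log_mul (by positivity) (by positivity), Real.log_mul (by positivity) (by positivity),
      Real.log_mul (by norm_num) (by positivity), Real.log_pow, Real.log_pow]; push_cast; ring
  rw [e, P.log_MmaxHPM]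
  rw [P.log_DmaxHPM] at hlogD ⊢
  have hl2 : Real.log 2 ≤ 1 := by linarith [Real.log_two_lt_d9]
  have hl4 : Real.log 4 ≤ 2 := by
    rw [show (4 : ℝ) = 2 ^ 2 by norm_num, Real.log_pow]; push_cast; linarith
  have hU := P.𝔘_ge'; have h2d : (1 : ℝ) ≤ 2 ^ d := one_le_pow₀ (by norm_num)
  unfold cLp' at hlogD ⊢
  -- the bracket is `≤ (7/64)·𝔘`, times `2^{d+2}` gives `(7/16)·2^d·𝔘`
  have hbr : Real.log 4 + 2 * (16 * (P.𝔘ℓ / 1024) + 2 * (P.𝔘ℓ / (2 * 2 ^ 12))) +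
      (Real.log 2 + 28 * (P.𝔘ℓ / 1024) + 4 * (P.𝔘ℓ / (2 * 2 ^ 12))) + 3 * Real.log Hprod ≤
        7 / 64 * P.𝔘ℓ := by
    nlinarith [show (2 : ℝ) ^ 98 ≥ 2 ^ 95 by norm_num]
  have h2d0 : (0 : ℝ) ≤ 2 ^ (d + 2) := by positivity
  calc (2 : ℝ) ^ (d + 2) * (Real.log 4 + 2 * (16 * (P.𝔘ℓ / 1024) + 2 * (P.𝔘ℓ / (2 * 2 ^ 12))) +
        (Real.log 2 + 28 * (P.𝔘ℓ / 1024) + 4 * (P.𝔘ℓ / (2 * 2 ^ 12))) + 3 * Real.log Hprod) -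
        (16 * (P.𝔘ℓ / 1024) + 2 * (P.𝔘ℓ / (2 * 2 ^ 12)))
      ≤ 2 ^ (d + 2) * (7 / 64 * P.𝔘ℓ) - 0 := by
        gcongr
    _ = 7 / 16 * (2 ^ d * P.𝔘ℓ) := by rw [pow_add]; ring

/-! ### Monotonicity of the Liouville threshold in the denominator and the size -/

omit P in
/-- **The half-step threshold `D/(4D²·M·H³)^E` is antitone in `D ≥ 1` and `M > 0`** (`E ≥ 1`): with
`1 ≤ D ≤ D'` and `0 < M ≤ M'`, `D'/(4D'²M'H³)^E ≤ D/(4D²MH³)^E`.  (Lets a per-`(s,τ)` denominator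
`D(s,τ) ≤ DmaxHPM` and size `Mb(s,τ) ≤ MmaxHPM` be replaced by the closed forms.) [folklore] -/
theorem threshold_antitone {D D' M M' H : ℝ} (hD : 1 ≤ D) (hDD' : D ≤ D') (hM : 0 < M) (hMM' : M ≤ M')
    (hH : 0 < H) {E : ℕ} (hE : 1 ≤ E) :
    D' / (4 * D' ^ 2 * M' * H ^ 3) ^ E ≤ D / (4 * D ^ 2 * M * H ^ 3) ^ E := by
  have hD0 : 0 < D := by linarith
  have hD'0 : 0 < D' := by linarith
  have hM'0 : 0 < M' := by linarith
  -- rewrite both sides as `1/(4MH³·D) · (1/(4D²MH³))^{E-1}`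
  obtain ⟨E', rfl⟩ : ∃ E', E = E' + 1 := ⟨E - 1, by omega⟩
  have key : ∀ {x m : ℝ}, 0 < x → 0 < m →
      x / (4 * x ^ 2 * m * H ^ 3) ^ (E' + 1) = (1 / (4 * m * H ^ 3 * x)) * (1 / (4 * x ^ 2 * m * H ^ 3)) ^ E' := by
    intro x m hx hm
    have h4 : (0 : ℝ) < 4 * x ^ 2 * m * H ^ 3 := by positivity
    rw [pow_succ, one_div_pow]
    field_simp
  rw [key hD'0 hM'0, key hD0 hM]
  have hA : 1 / (4 * M' * H ^ 3 * D') ≤ 1 / (4 * M * H ^ 3 * D) := by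
    apply one_div_le_one_div_of_le (by positivity)
    have h1 : 4 * M * H ^ 3 * D ≤ 4 * M' * H ^ 3 * D := by
      have : 0 ≤ 4 * H ^ 3 * D := by positivity
      nlinarith
    have h2 : 4 * M' * H ^ 3 * D ≤ 4 * M' * H ^ 3 * D' := by
      have : 0 ≤ 4 * M' * H ^ 3 := by positivity
      nlinarith
    linarith
  have hB : 1 / (4 * D' ^ 2 * M' * H ^ 3) ≤ 1 / (4 * D ^ 2 * M * H ^ 3) := by
    apply one_div_le_one_div_of_le (by positivity)
    have hsq : D ^ 2 ≤ D' ^ 2 := pow_le_pow_left₀ hD0.le hDD' 2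
    have h1 : 4 * D ^ 2 * M * H ^ 3 ≤ 4 * D' ^ 2 * M * H ^ 3 := by
      have : 0 ≤ 4 * M * H ^ 3 := by positivity
      nlinarith
    have h2 : 4 * D' ^ 2 * M * H ^ 3 ≤ 4 * D' ^ 2 * M' * H ^ 3 := by
      have : 0 ≤ 4 * D' ^ 2 * H ^ 3 := by positivity
      nlinarith
    linarith
  have hB0 : 0 ≤ 1 / (4 * D' ^ 2 * M' * H ^ 3) := by positivity
  exact mul_le_mul hA (pow_le_pow_left₀ hB0 hB E') (by positivity) (by positivity)

end PadicW80ParL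

end Summit.ABC.StewartYu

end
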